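import Mathlib
import HarnessLib
import Summits.Ventures.LatticeQCDFlow.Scaling.LinearFamilyTilt
import Summits.Ventures.LatticeQCDFlow.Scaling.LinearFamilyStepMGF
import Summits.Ventures.LatticeQCDFlow.Scaling.TiltedProtocolRecursion
import Summits.Ventures.LatticeQCDFlow.Scaling.TiltedProtocolMass
import Summits.Ventures.LatticeQCDFlow.Scaling.GeneralLayerLagLaw

/-!
# TiltedProtocolMoments — the `t`-tilted recursion of the linear switching protocol with ARBITRARY
# relaxation layers: `E_F[e^{−tW}]` as a tilted mass, its perfect-relaxation value
# `p_n^{(t)} = exp(Σ_k Λ_k(t) − t·ΔF)`, and the per-step mass / deviation inequalities for every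
# real `t` (the `t = 2` instance with hand-optimised constants is `Scaling/TiltedLinearProtocol`)

HONEST FRAMING: exact (Metropolis-corrected) sampling algorithms for lattice gauge theory;
figures of merit are autocorrelation/cost numbers at stated couplings and volumes; no
continuum-physics claim.

Venture `LatticeQCDFlow` (cell pub-lqcd), topic `Scaling`; FANOUT row 19 (`su2-snf`, GEN-6).
OUR WORK (elementary finite sums), nothing here is cited as a fact.  Vocabulary:
`Scaling/TiltedProtocolMass` (GEN-10; the `t`-tilted recursion `tWeight` / `tTiltLaw` / `tPerfMass`,
`E_F[e^{−tW}] = |ν_n^{(t)}|`, `log p_n^{(t)} + t·ΔF = Σ_k Λ_k(t)` — formerly §1 of this file) and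
`Scaling/TiltedLinearProtocol` (this seat).  For general layers (`|D x − D y| ≤ ΔD`,
`Var_c(D) ≤ σ̄²` for all `c`, writing `A₁ = |tδ_k|ΔD`, `A₂ = |tδ_k − δ_k|ΔD`, `m_k = |ν_k|`,
`E_k = massDev π_{c_k} ν_k`, `ḡ_k = π_{c_k}[g_k]`):

* `sqrt_varLaw_tWeight_le_of_osc` — `√Var(g_k) ≤ ḡ_k|tδ_k|e^{A₁/2}√Var_{c_k+tδ_k}(D)` (the
  sup-norm-free form `ḡ_k√(e^{Λ(2)}−1)` is `Scaling/TiltedProtocolMass.sqrt_varLaw_tWeight_le`);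
* `sum_tTiltLaw_succ_le` — TILTED MASS: `m_{k+1} ≤ ḡ_k·(m_k + |tδ_k|·e^{A₁/2}·σ̄·E_k)`;
* `massDev_tTiltLaw_succ_le` — DEVIATION (positive unit-row-sum layers `χ²`-contracting towards
  `π_{c_{k+1}}` with `ρ ≥ 0`):
  `E_{k+1} ≤ ρ·ḡ_k·(e^{(5A₁+2A₂)/4}·E_k + |tδ_k − δ_k|·e^{A₂/2}·σ̄·m_k)` (certificate
  `g_k²π_{c_k} ≤ (e^{(A₁+A₂)/2}ḡ_k)²π_{c_{k+1}}`; the relative standard deviation of `g_k` folded in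
  by `exp_add_mul_le_exp_of_sq_le` of `Scaling/LinearFamilyStepMGF`);
* at `t = 1` the deviation source vanishes (`A₂ = 0`, `|tδ − δ| = 0`): Jarzynski's equality has no
  lag; at `t = 0` the mass is constant.

NOT CLAIMED: any value of `ρ`, `σ̄`, `ΔD` for a lattice kernel; non-positive layers.
-/

namespace Summit.Ventures.LatticeQCDFlow.Scaling

open Finset
open Literature.Probability.MarkovChains (IsRowStochastic IsStationary stepLaw)
open Literature.Probability.ImportanceSampling (chiSqDiv chiSqDiv_def chiSqDiv_eq_sum_sq_div)
open Summit.Ventures.LatticeQCDFlow.Exactness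
open Summit.Ventures.LatticeQCDFlow.Theory2

variable {X : Type*} [Fintype X]

/-! ## The `t`-tilted recursion of the linear protocol -/

section Protocol

variable [Nonempty X]

/-! ## The two per-step inequalities (general `t`) -/

/-- `√Var_{π_{c_k}}(g_k) ≤ ḡ_k · |tδ_k| e^{|tδ_k|ΔD/2} √Var_{c_k+tδ_k}(D)`. -/
theorem sqrt_varLaw_tWeight_le_of_osc (t : ℝ) (S₀ D : X → ℝ) (c : ℕ → ℝ) {ΔD : ℝ}
    (hD : ∀ x y, |D x - D y| ≤ ΔD) (k : ℕ) :
    Real.sqrt (varLaw (gibbsLaw (linAction S₀ D (c k))) (tWeight t D c k))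
      ≤ (∑ x, gibbsLaw (linAction S₀ D (c k)) x * tWeight t D c k x)
          * (Real.exp (|t * (c (k + 1) - c k)| * ΔD / 2) * (|t * (c (k + 1) - c k)|
              * Real.sqrt (varD S₀ D (c k + t * (c (k + 1) - c k))))) := by
  rw [sqrt_varLaw_eq_mul_sqrt_chiSqDiv (gibbsLaw_pos _) (sum_gibbsLaw _) (tEqFactor_pos t S₀ D c k),
    tilt_gibbsLaw_eq_t]
  refine mul_le_mul_of_nonneg_left ?_ (tEqFactor_pos t S₀ D c k).le
  have h := sqrt_chiSqDiv_gibbsLaw_linAction_le S₀ D hD (c k + t * (c (k + 1) - c k)) (c k)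
  have habs : |c k - (c k + t * (c (k + 1) - c k))| = |t * (c (k + 1) - c k)| := by
    rw [show c k - (c k + t * (c (k + 1) - c k)) = -(t * (c (k + 1) - c k)) by ring, abs_neg]
  rwa [habs] at h

/-- **TILTED MASS STEP (general `t`).**  `m_{k+1} ≤ ḡ_k·(m_k + |tδ_k|·e^{|tδ_k|ΔD/2}·σ̄·E_k)`. -/
theorem sum_tTiltLaw_succ_le (t : ℝ) (S₀ D : X → ℝ) (c : ℕ → ℝ) (P : ℕ → X → X → ℝ)
    {ΔD σbar : ℝ} (hD : ∀ x y, |D x - D y| ≤ ΔD) (hProw : ∀ k x, ∑ y, P k x y = 1)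
    (hσ0 : 0 ≤ σbar) (hσ : ∀ c, varD S₀ D c ≤ σbar ^ 2) (k : ℕ) :
    ∑ x, tTiltLaw t S₀ D c P (k + 1) x
      ≤ (∑ x, gibbsLaw (linAction S₀ D (c k)) x * tWeight t D c k x)
          * (∑ x, tTiltLaw t S₀ D c P k x
              + |t * (c (k + 1) - c k)| * Real.exp (|t * (c (k + 1) - c k)| * ΔD / 2) * σbar
                  * massDev (gibbsLaw (linAction S₀ D (c k))) (tTiltLaw t S₀ D c P k)) := by
  rw [tTiltLaw_succ, sum_stepLaw_of_rowsum (hProw k)]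
  have hlag := abs_sum_mul_sub_mass_mul_le (gibbsLaw_pos (linAction S₀ D (c k))) (sum_gibbsLaw _)
    (tTiltLaw t S₀ D c P k) (tWeight t D c k)
  have hsd := sqrt_varLaw_tWeight_le_of_osc t S₀ D c hD k
  have hvD : Real.sqrt (varD S₀ D (c k + t * (c (k + 1) - c k))) ≤ σbar := by
    rw [← Real.sqrt_sq hσ0]; exact Real.sqrt_le_sqrt (hσ _)
  have hE := massDev_nonneg (gibbsLaw (linAction S₀ D (c k))) (tTiltLaw t S₀ D c P k)
  have hg := (tEqFactor_pos t S₀ D c k).le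
  have h2 : 0 ≤ Real.exp (|t * (c (k + 1) - c k)| * ΔD / 2) * |t * (c (k + 1) - c k)| := by
    positivity
  have hsd' : Real.sqrt (varLaw (gibbsLaw (linAction S₀ D (c k))) (tWeight t D c k))
      ≤ (∑ x, gibbsLaw (linAction S₀ D (c k)) x * tWeight t D c k x)
          * (Real.exp (|t * (c (k + 1) - c k)| * ΔD / 2) * |t * (c (k + 1) - c k)| * σbar) :=
    hsd.trans (mul_le_mul_of_nonneg_left (by
      rw [mul_assoc]; exact mul_le_mul_of_nonneg_left (mul_le_mul_of_nonneg_left hvD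
        (abs_nonneg _)) (Real.exp_pos _).le) hg)
  have := (le_abs_self _).trans hlag
  nlinarith [mul_le_mul_of_nonneg_right hsd' hE]

/-- **The change-of-reference certificate (general `t`)**:
`g_k(x)²·π_{c_k}(x) ≤ (e^{(|tδ_k| + |tδ_k − δ_k|)ΔD/2}·ḡ_k)²·π_{c_{k+1}}(x)`. -/
theorem tWeight_sq_mul_gibbsLaw_le (t : ℝ) (S₀ D : X → ℝ) (c : ℕ → ℝ) {ΔD : ℝ}
    (hD : ∀ x y, |D x - D y| ≤ ΔD) (k : ℕ) (x : X) :
    tWeight t D c k x ^ 2 * gibbsLaw (linAction S₀ D (c k)) x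
      ≤ (Real.exp ((|t * (c (k + 1) - c k)| + |t * (c (k + 1) - c k) - (c (k + 1) - c k)|) * ΔD / 2)
            * ∑ y, gibbsLaw (linAction S₀ D (c k)) y * tWeight t D c k y) ^ 2
          * gibbsLaw (linAction S₀ D (c (k + 1))) x := by
  set δ := c (k + 1) - c k with hδ
  set π := gibbsLaw (linAction S₀ D (c k)) with hπ
  have hπpos : ∀ y, 0 < π y := fun y => gibbsLaw_pos _ y
  have hπ1 : ∑ y, π y = 1 := sum_gibbsLaw _
  have hπ' : gibbsLaw (linAction S₀ D (c (k + 1))) x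
      = π x * Real.exp (-(δ * D x)) / ∑ y, π y * Real.exp (-(δ * D y)) := by
    have h := gibbsLaw_linAction_add S₀ D (c k) δ x
    rwa [show c k + δ = c (k + 1) by rw [hδ]; ring] at h
  set hbar := ∑ y, π y * Real.exp (-(δ * D y)) with hhbar
  have hhpos : 0 < hbar := sum_pos (fun y _ => mul_pos (hπpos y) (Real.exp_pos _)) univ_nonempty
  set gbar := ∑ y, π y * tWeight t D c k y with hgbar
  set A := (|t * δ| + |t * δ - δ|) * ΔD with hA
  have hA2 : Real.exp (A / 2) ^ 2 = Real.exp A := by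
    rw [← Real.exp_nat_mul]; congr 1; push_cast; ring
  have key : tWeight t D c k x ^ 2 * hbar ≤ Real.exp A * gbar ^ 2 * Real.exp (-(δ * D x)) := by
    have lhs : tWeight t D c k x ^ 2 * hbar
        = ∑ y, ∑ y', π y * π y' * Real.exp (-(2 * (t * δ) * D x) - δ * D y) := by
      rw [hhbar, mul_sum]
      refine sum_congr rfl fun y _ => ?_
      rw [show tWeight t D c k x ^ 2 * (π y * Real.exp (-(δ * D y)))
          = (π y * (tWeight t D c k x ^ 2 * Real.exp (-(δ * D y)))) * ∑ y', π y' by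
            rw [hπ1]; ring, mul_sum]
      refine sum_congr rfl fun y' _ => ?_
      simp only [tWeight, ← hδ]
      rw [sq, ← Real.exp_add, ← Real.exp_add]
      ring_nf
    have rhs : Real.exp A * gbar ^ 2 * Real.exp (-(δ * D x))
        = ∑ y, ∑ y', π y * π y'
            * Real.exp (A - t * δ * D y - t * δ * D y' - δ * D x) := by
      rw [hgbar, sq, sum_mul_sum, mul_sum, sum_mul]
      refine sum_congr rfl fun y _ => ?_
      rw [mul_sum, sum_mul]
      refine sum_congr rfl fun y' _ => ?_
      simp only [tWeight, ← hδ]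
      rw [show A - t * δ * D y - t * δ * D y' - δ * D x
          = A + -(t * δ * D y) + -(t * δ * D y') + -(δ * D x) by ring,
        Real.exp_add, Real.exp_add, Real.exp_add]
      ring
    rw [lhs, rhs]
    refine sum_le_sum fun y _ => sum_le_sum fun y' _ => ?_
    refine mul_le_mul_of_nonneg_left (Real.exp_le_exp.mpr ?_)
      (mul_nonneg (hπpos y).le (hπpos y').le)
    have h1 : |(t * δ - δ) * (D x - D y)| ≤ |t * δ - δ| * ΔD := by
      rw [abs_mul]; exact mul_le_mul_of_nonneg_left (hD x y) (abs_nonneg _)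
    have h2 : |t * δ * (D x - D y')| ≤ |t * δ| * ΔD := by
      rw [abs_mul]; exact mul_le_mul_of_nonneg_left (hD x y') (abs_nonneg _)
    have h1' := (abs_le.mp h1).1
    have h2' := (abs_le.mp h2).1
    rw [hA]
    nlinarith [h1', h2']
  rw [hπ',
    show (Real.exp (A / 2) * gbar) ^ 2 * (π x * Real.exp (-(δ * D x)) / hbar)
      = (Real.exp (A / 2) ^ 2 * gbar ^ 2 * Real.exp (-(δ * D x)) * π x) / hbar by ring,
    le_div_iff₀ hhpos, hA2]
  linarith [mul_le_mul_of_nonneg_right key (hπpos x).le]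

/-- **DEVIATION STEP (general `t`).**  If `P k` is positive with unit row sums and `χ²`-contracts
towards `π_{c_{k+1}}` with `ρ ≥ 0`, then with `A₁ = |tδ_k|ΔD`, `A₂ = |tδ_k − δ_k|ΔD`:
`E_{k+1} ≤ ρ·ḡ_k·(e^{(5A₁ + 2A₂)/4}·E_k + |tδ_k − δ_k|·e^{A₂/2}·σ̄·m_k)`. -/
theorem massDev_tTiltLaw_succ_le (t : ℝ) (S₀ D : X → ℝ) (c : ℕ → ℝ) (P : ℕ → X → X → ℝ)
    {ΔD ρ σbar : ℝ} (hD : ∀ x y, |D x - D y| ≤ ΔD) (hPpos : ∀ k x y, 0 < P k x y)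
    (hProw : ∀ k x, ∑ y, P k x y = 1)
    (hK : ∀ k, ChiSqContracts (P k) (gibbsLaw (linAction S₀ D (c (k + 1)))) ρ) (hρ : 0 ≤ ρ)
    (hσ0 : 0 ≤ σbar) (hσ : ∀ c, varD S₀ D c ≤ σbar ^ 2) (k : ℕ) :
    massDev (gibbsLaw (linAction S₀ D (c (k + 1)))) (tTiltLaw t S₀ D c P (k + 1))
      ≤ ρ * (∑ x, gibbsLaw (linAction S₀ D (c k)) x * tWeight t D c k x)
          * (Real.exp ((5 * (|t * (c (k + 1) - c k)| * ΔD)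
                + 2 * (|t * (c (k + 1) - c k) - (c (k + 1) - c k)| * ΔD)) / 4)
                * massDev (gibbsLaw (linAction S₀ D (c k))) (tTiltLaw t S₀ D c P k)
            + |t * (c (k + 1) - c k) - (c (k + 1) - c k)|
                * Real.exp (|t * (c (k + 1) - c k) - (c (k + 1) - c k)| * ΔD / 2) * σbar
                * ∑ x, tTiltLaw t S₀ D c P k x) := by
  set δ := c (k + 1) - c k with hδ
  set π := gibbsLaw (linAction S₀ D (c k)) with hπ
  set π' := gibbsLaw (linAction S₀ D (c (k + 1))) with hπ'
  set ν := tTiltLaw t S₀ D c P k with hν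
  set g := tWeight t D c k with hg
  set gbar := ∑ x, π x * g x with hgbar
  set A₁ := |t * δ| * ΔD with hA₁
  set A₂ := |t * δ - δ| * ΔD with hA₂
  have hπpos : ∀ y, 0 < π y := fun y => gibbsLaw_pos _ y
  have hπ1 : ∑ y, π y = 1 := sum_gibbsLaw _
  have hπ'pos : ∀ y, 0 < π' y := fun y => gibbsLaw_pos _ y
  have hπ'1 : ∑ y, π' y = 1 := sum_gibbsLaw _
  have hgbar0 : 0 < gbar := tEqFactor_pos t S₀ D c k
  have hνpos : ∀ x, 0 < ν x := fun x => tTiltLaw_pos hPpos k x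
  have hm0 : 0 < ∑ x, ν x := sum_pos (fun x _ => hνpos x) univ_nonempty
  have hgν0 : ∑ x, g x * ν x ≠ 0 :=
    (sum_pos (fun x _ => mul_pos (tWeight_pos t D c k x) (hνpos x)) univ_nonempty).ne'
  have hE := massDev_nonneg π ν
  have hΔ : 0 ≤ ΔD := (abs_nonneg _).trans (hD (Classical.arbitrary X) (Classical.arbitrary X))
  have hA₁0 : 0 ≤ A₁ := mul_nonneg (abs_nonneg _) hΔ
  have hA₂0 : 0 ≤ A₂ := mul_nonneg (abs_nonneg _) hΔ
  -- (1) contraction by the layer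
  have h1 : massDev π' (tTiltLaw t S₀ D c P (k + 1)) ≤ ρ * massDev π' (fun x => g x * ν x) := by
    rw [tTiltLaw_succ]
    exact massDev_stepLaw_le (hK k) (hProw k) hρ hgν0
  -- (2) tilt and change of reference
  have hC0 : 0 ≤ Real.exp ((A₁ + A₂) / 2) * gbar := by positivity
  have hcert : ∀ x, g x ^ 2 * π x ≤ (Real.exp ((A₁ + A₂) / 2) * gbar) ^ 2 * π' x := by
    intro x
    have h := tWeight_sq_mul_gibbsLaw_le t S₀ D c hD k x
    rw [show (|t * (c (k + 1) - c k)| + |t * (c (k + 1) - c k) - (c (k + 1) - c k)|) * ΔD / 2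
        = (A₁ + A₂) / 2 by rw [hA₁, hA₂, hδ]; ring] at h
    exact h
  have h2 := massDev_tilt_le (ν := ν) hπpos hπ1 hπ'pos hπ'1 hgbar0 hC0 hcert
  rw [abs_of_pos hm0] at h2
  -- (3) the Gibbs-family bounds
  have htilt : (fun x => π x * g x / ∑ y, π y * g y)
      = gibbsLaw (linAction S₀ D (c k + t * δ)) := tilt_gibbsLaw_eq_t t S₀ D c k
  have hd' : Real.sqrt (chiSqDiv (fun x => π x * g x / ∑ y, π y * g y) π')
      ≤ Real.exp (A₂ / 2) * (|t * δ - δ| * σbar) := by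
    rw [htilt]
    have h := sqrt_chiSqDiv_gibbsLaw_linAction_le S₀ D hD (c k + t * δ) (c (k + 1))
    have habs : |c (k + 1) - (c k + t * δ)| = |t * δ - δ| := by
      rw [show c (k + 1) - (c k + t * δ) = -(t * δ - δ) by rw [hδ]; ring, abs_neg]
    rw [habs, show |t * δ - δ| * ΔD / 2 = A₂ / 2 by rw [hA₂]] at h
    refine h.trans (mul_le_mul_of_nonneg_left (mul_le_mul_of_nonneg_left ?_ (abs_nonneg _))
      (Real.exp_pos _).le)
    rw [← Real.sqrt_sq hσ0]; exact Real.sqrt_le_sqrt (hσ _)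
  have hsd := sqrt_varLaw_tWeight_le_of_osc t S₀ D c hD k
  -- relative standard deviation folded into the contraction factor
  have hy2 : (|t * δ| * Real.sqrt (varD S₀ D (c k + t * δ))) ^ 2 ≤ A₁ ^ 2 / 2 := by
    have hv := varD_le_sq_of_osc S₀ D hD (c k + t * δ)
    have hv0 := varD_nonneg S₀ D (c k + t * δ)
    rw [mul_pow, Real.sq_sqrt hv0, hA₁, mul_pow]
    nlinarith [sq_nonneg (t * δ), sq_abs (t * δ)]
  have hfold := exp_add_mul_le_exp_of_sq_le (a := (A₁ + A₂) / 2) (c := A₁ / 2)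
    (by linarith) (by positivity) hA₁0 hy2
  rw [show (A₁ + A₂) / 2 + 3 * A₁ / 4 = (5 * A₁ + 2 * A₂) / 4 by ring] at hfold
  have hsd' : Real.sqrt (varLaw π g)
      ≤ gbar * (Real.exp (A₁ / 2) * (|t * δ| * Real.sqrt (varD S₀ D (c k + t * δ)))) := by
    have := hsd
    rw [show |t * (c (k + 1) - c k)| * ΔD / 2 = A₁ / 2 by rw [hA₁, hδ]] at this
    exact this
  -- assemble
  have hsum : Real.exp ((A₁ + A₂) / 2) * gbar * massDev π ν
        + (∑ x, ν x) * gbar * Real.sqrt (chiSqDiv (fun x => π x * g x / ∑ y, π y * g y) π')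
        + Real.sqrt (varLaw π g) * massDev π ν
      ≤ gbar * (Real.exp ((5 * A₁ + 2 * A₂) / 4) * massDev π ν
          + |t * δ - δ| * Real.exp (A₂ / 2) * σbar * ∑ x, ν x) := by
    have t2 := mul_le_mul_of_nonneg_left hd' (mul_nonneg hm0.le hgbar0.le)
    have t3 := mul_le_mul_of_nonneg_right hsd' hE
    have t13 : Real.exp ((A₁ + A₂) / 2) * gbar * massDev π ν
          + gbar * (Real.exp (A₁ / 2) * (|t * δ| * Real.sqrt (varD S₀ D (c k + t * δ))))
              * massDev π ν
        ≤ gbar * (Real.exp ((5 * A₁ + 2 * A₂) / 4) * massDev π ν) := by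
      have := mul_le_mul_of_nonneg_right hfold (mul_nonneg hgbar0.le hE)
      nlinarith [this]
    nlinarith [t2, t3, t13]
  calc massDev π' (tTiltLaw t S₀ D c P (k + 1))
      ≤ ρ * massDev π' (fun x => g x * ν x) := h1
    _ ≤ ρ * (gbar * (Real.exp ((5 * A₁ + 2 * A₂) / 4) * massDev π ν
          + |t * δ - δ| * Real.exp (A₂ / 2) * σbar * ∑ x, ν x)) :=
        mul_le_mul_of_nonneg_left (h2.trans hsum) hρ
    _ = _ := by rw [hA₁, hA₂]; ring

end Protocol

end Summit.Ventures.LatticeQCDFlow.Scaling
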